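import Literature.AlgebraicGeometry.Motives.AbelianVarietyKummerAnalyticUnit
import HarnessLib

/-!
# The algebraic Kummer pairing of a complex abelian variety IS the analytic torsion pairing of its
# uniformising torus: `e_N(σ, D) = q⁽ᴺ⁾(s, t)⁻¹` (Lang VII §2 ↔ Lange 2023 §2.7.4 Exercise (3))

Layer `Literature/AlgebraicGeometry/Motives`, namespace `Literature.AlgebraicGeometry.Motives.AbelianVariety`.  PROOF FILE
(theorems only; no definition, no named fact).  The JUNCTION between the tree's two Weil/Kummer pairings of a complex
abelian variety `A` uniformised by `φ : X = V/Λ → A(ℂ)` (the J′ variable block): the ALGEBRAIC Kummer pairing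
`e_N(σ, D) = kummerConst hh σ ∈ ℂ` (Lang, *Abelian Varieties*, VII §2: the constant `c` with `t_σ^♯ h = c · h` for a
trivializer `h` of `[N]^* D`) and the ANALYTIC torsion pairing `q⁽ᴺ⁾ : X × X̂ → ℂ` of Lange 2023, §2.7.4 Exercise (3)
(`ComplexTorus.torsionPairing`, `= χ_t(N s̃)` on `X_N × X̂_N`):

  `kummerConst hh σ = (torsionPairing Φ N s t)⁻¹`   for `σ = φ(s)`, `L(0, χ_t) = [𝒪(D)^an]`.

POLARITY (r1 of the route memo): Lang's `e_N(σ, D) = (t_σ^♯ h)/h` and Lange's `q⁽ᴺ⁾` differ by an inversion — the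
tree's `kummerConst` docstring already records «`ē_m(a, a') = g/g∘t_a` … up to the inversion `a ↦ −a`» (Milne §16);
we state the identity exactly as it comes out: `e_N(σ, D) · q⁽ᴺ⁾(s, t) = 1`.

Proof (sequel of `AbelianVarietyKummerAnalyticUnit`): by `exists_kummerUnit` the unit `r_i = ([N]^♯ f_i) h`, read on
`V` and multiplied by the local theta function `G_i(N ·)` of `𝒪(D)^an` for `χ_t`, is a non-zero CONSTANT `c₀`, and
`N t = 0`.  Since `σ` is `N`-torsion, `t_σ^♯ r_i = e_N(σ, D) · r_i` (`translFF_functionFieldMap_zsmul`,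
`translFF_eq_kummerConst_smul`), so reading at `x = φ(π v)` and `σ x = φ(π (v + s̃))`
(`AbelianVarietyKummerPairingPoints`): `e_N(σ, D) = r_i(σ x)/r_i(x) = G_i(N v)/G_i(N v + Φ m) = χ_t(m)⁻¹` where
`N s̃ = Φ m`; and `χ_t(m) = q⁽ᴺ⁾(s, t)` (`torsionPairing_proj_eq_pointChar`).

* `kummerConst_mul_torsionPairing_eq_one`, `kummerConst_eq_torsionPairing_inv` — the junction.

Purpose (cell hodgecm-mathlib, U-DAG node D5 «algebraic ↔ analytic Weil pairing»): with ★
`picClass_cartierDivisorLineBundle_weilDiv` (`t = φ_H(w̄)` for `D = t_w^*Θ − Θ`) and ★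
`torsionPairing_phiH_eq_weilPairing_of_zsmul_eq` this turns the algebraic `weilPairingLevel Θ` into Lange's
`ε^L = e(−2πi·Im H)` on the uniformising torus.

## References
* [Lang1983AbelianVarieties] S. Lang, *Abelian Varieties*, Ch. VII §2, Props. 3–5.
* [Lange2023AbelianVarietiesComplex] H. Lange, *Abelian Varieties over the Complex Numbers* (2023), §2.7.4 Exercise (3),
  §1.4.1 Prop. 1.4.1, §1.3.2 Thm. 1.3.3.
* [Milne1986AbelianVarieties] J. S. Milne, *Abelian varieties* (1986), §16, p. 132 (the inversion `a ↦ −a`).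
-/

noncomputable section

open CategoryTheory AlgebraicGeometry TopologicalSpace Set Function Filter
open scoped Manifold Topology
open Literature.Geometry.Kaehler Literature.Geometry.Kaehler.ComplexTorus
open Literature.NumberTheory.Transcendental Literature.AlgebraicGeometry.HodgeTheory

namespace Literature.AlgebraicGeometry.Motives.AbelianVariety

open RatFn AlgPoints

section KummerAnalytic

variable {A : AbelianVariety ℂ} {ι : Type} [Fintype ι] [DecidableEq ι] {Φ : (ι → ℝ) ≃L[ℝ] (Fin A.dim → ℂ)}
  {φ : ComplexTorus Φ → ComplexPoints A.X} (hφ : IsAnalytification (Fin A.dim → ℂ) A.X A.dim φ)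
  (hadd : ∀ x y, φ (x + y) = φ x * φ y)

include hadd in
omit [Fintype ι] [DecidableEq ι] in
/-- `φ 0 = 1`. [cite: Lange2023AbelianVarietiesComplex, §1.1] -/
private theorem map_zero_eq_one : φ 0 = 1 := by
  have h := hadd 0 0
  rw [add_zero] at h
  exact mul_eq_left.mp h.symm

/-- `χ_{N t} = χ_t(N ·)`. [cite: Lange2023AbelianVarietiesComplex, §1.4.1 Prop. 1.4.1] -/
private theorem pointChar_nsmul_left (t : Dual Φ) (N : ℕ) (n : ι → ℤ) :
    pointChar Φ (N • t) n = pointChar Φ t n ^ N := by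
  induction N with
  | zero => rw [zero_smul, pow_zero, pointChar_zero]; rfl
  | succ k ih => rw [succ_nsmul, pointChar_add, Pi.mul_apply, ih, pow_succ]

include hφ hadd in
/-- **The junction `e_N(σ, D) · q⁽ᴺ⁾(s, t) = 1`** between Lang's algebraic Kummer pairing and Lange's analytic torsion
pairing (module docstring). Hypotheses: `hh : [N]^* D + div h = 0`, `ht : L(0, χ_t) = [𝒪(D)^an]` in `Pic(X)`,
`σ = φ(s)` an `N`-torsion point. [cite: Lang1983AbelianVarieties, Ch. VII §2 Props. 3–5]
[cite: Lange2023AbelianVarietiesComplex, §2.7.4 Exercise (3) and §1.3.2 Thm. 1.3.3] -/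
theorem kummerConst_mul_torsionPairing_eq_one {N : ℕ} [IsDominant (Hom.toSchemeHom ((N : ℤ) • 𝟙 A))]
    (D : CartierDivisor A.X.left) {h : A.X.left.functionField} (hh : A.IsTrivializer (n := N) D h)
    (t : Dual Φ)
    (ht : ((dualEquivPicZero Φ (Multiplicative.ofAdd t) : picZero Φ) : Pic Φ) =
      picClass (cartierDivisorLineBundle hφ D))
    (s : ComplexTorus Φ) (σ : A.torsionPoints ℂ N) (hσ : (σ : A.Points ℂ) = φ s) :
    (A.kummerConst hh σ : ℂ) * torsionPairing Φ (N : ℤ) s t = 1 := by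
  classical
  obtain ⟨G, c₀, hc₀, hGe, hG0, hχN, hunit⟩ := exists_kummerUnit hφ hadd D hh t ht
  -- lift `s` to `V` and write `N s̃ = Φ m`
  obtain ⟨sv, hsv⟩ := cover_surjective Φ s
  have hNsv0 : cover Φ (N • sv) = 0 := by
    apply hφ.isHomeomorph.injective
    rw [map_cover_nsmul A hadd, hsv, ← hσ, coe_torsionPoints_pow_eq_one, map_zero_eq_one hadd]
  obtain ⟨m, hm⟩ : ∃ m : ι → ℤ, N • sv = latticeVec Φ m := by
    have h0 : proj Φ (Φ.symm (N • sv)) = 0 := by rw [← cover_apply]; exact hNsv0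
    obtain ⟨m, hm⟩ := (proj_eq_zero_iff Φ).1 h0
    refine ⟨m, ?_⟩
    rw [show latticeVec Φ m = Φ (intVec m) from rfl, ← hm, ContinuousLinearEquiv.apply_symm_apply]
  -- base point `v = 0`, an index `i` with `[N] x_0 ∈ U_i`, the unit `r_i` and its section `w` on `W_i = [N]⁻¹ U_i`
  set v : Fin A.dim → ℂ := 0 with hvdef
  obtain ⟨i, hi⟩ := D.covers (φ (cover Φ (N • v))).pt
  set zN : A.X ⟶ A.X := ((N : ℤ) • 𝟙 A).hom.hom.hom with hzN
  have hNpt : ∀ u : Fin A.dim → ℂ, AlgPoints.map zN (φ (cover Φ u)) = φ (cover Φ (N • u)) := by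
    intro u
    rw [hzN, map_zsmul_one, map_cover_nsmul A hadd]
  have hNpt' : ∀ u : Fin A.dim → ℂ, zN.left (φ (cover Φ u)).pt = (φ (cover Φ (N • u))).pt := by
    intro u
    rw [← hNpt, AlgPoints.pt_map]
  set W : A.X.left.Opens := zN.left ⁻¹ᵁ (D.U i) with hWdef
  set r : A.X.left.functionField := functionFieldMap zN.left (D.f i) * h with hrdef
  have hunitr : ∀ y ∈ W, IsUnitAt y r := fun y hy ↦ hh.2 i y hy
  have hx : (φ (cover Φ v)).pt ∈ W := by
    change zN.left (φ (cover Φ v)).pt ∈ D.U i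
    rwa [hNpt']
  -- the translated point `σ · x = φ(π (v + s̃))` and `[N](σ x) = [N] x`
  have hNvs : N • (v + sv) = N • v + latticeVec Φ m := by rw [smul_add, hm]
  have hi' : (φ (cover Φ (N • (v + sv)))).pt ∈ D.U i := by
    rwa [hNvs, cover_add_latticeVec]
  have hxs : (φ (cover Φ (v + sv))).pt ∈ W := by
    change zN.left (φ (cover Φ (v + sv))).pt ∈ D.U i
    rwa [hNpt']
  have hσx : (σ : A.Points ℂ) * φ (cover Φ v) = φ (cover Φ (v + sv)) := by
    rw [cover_add' A, hadd, hsv, ← hσ, mul_comm]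
  set w : Γ(A.X.left, W) := sectionOf (genericPoint_mem_of_mem hx) r (fun y hy ↦ (hunitr y hy).isRegularAt)
    with hwdef
  have hw : ofSection (genericPoint_mem_of_mem hx) w = r := ofSection_sectionOf _ _ _
  have hw' : ofSection (genericPoint_mem_of_mem hxs) w = r := ofSection_sectionOf _ _ _
  -- the two readings of the constant `c₀`
  have e1 : evalOrZero W w (φ (cover Φ v)) * G i (N • v) = c₀ := hunit i v W w hx hi hw
  have e2 : evalOrZero W w (φ (cover Φ (v + sv))) * G i (N • (v + sv)) = c₀ := hunit i (v + sv) W w hxs hi' hw'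
  rw [hNvs, hGe] at e2
  -- the translation: `t_σ^♯ r = e_N(σ, D) · r`, read at `x`
  have hσN : (σ : A.Points ℂ) ^ N = 1 := coe_torsionPoints_pow_eq_one σ
  have htrN : A.translFF (σ : A.Points ℂ) (functionFieldMap zN.left (D.f i)) = functionFieldMap zN.left (D.f i) :=
    A.translFF_functionFieldMap_zsmul _ hσN (D.f i)
  have htr : A.translFF (σ : A.Points ℂ) r = algebraMap ℂ _ (A.kummerConst hh σ) * r := by
    rw [hrdef, _root_.map_mul, htrN, A.translFF_eq_kummerConst_smul hh σ]
    ring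
  have hxt : (φ (cover Φ v)).pt ∈ (A.translation (σ : A.Points ℂ)).left ⁻¹ᵁ W := by
    change (A.translation (σ : A.Points ℂ)).left (φ (cover Φ v)).pt ∈ W
    have : (AlgPoints.map (A.translation (σ : A.Points ℂ)) (φ (cover Φ v))).pt ∈ W := by
      rw [map_translation, hσx]; exact hxs
    exact this
  have H : ofSection (genericPoint_mem_of_mem hxt) ((A.translation (σ : A.Points ℂ)).left.app W w) =
      ofSection (genericPoint_mem_of_mem (show (φ (cover Φ v)).pt ∈ (⊤ : A.X.left.Opens) from trivial))
          (A.X.hom.appTop ((Scheme.ΓSpecIso (.of ℂ)).inv (A.kummerConst hh σ))) *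
        ofSection (genericPoint_mem_of_mem hx) w := by
    rw [A.ofSection_translation_app _ (genericPoint_mem_of_mem hx) w, hw, htr]
    congr 1
  have hval := AlgPoints.evalOrZero_eq_mul_of_ofSection_eq _ _ _ hxt
    (show (φ (cover Φ v)).pt ∈ (⊤ : A.X.left.Opens) from trivial) hx H
  rw [← AlgPoints.evalOrZero_map, map_translation, hσx, AlgPoints.evalOrZero_top_hom_appTop] at hval
  -- `hval : w(σ x) = c * w(x)`; combine with `e1`, `e2`
  have hG : G i (N • v) ≠ 0 := hG0 i _ hi
  have hwx : evalOrZero W w (φ (cover Φ v)) ≠ 0 := by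
    intro h0
    rw [h0, zero_mul] at e1
    exact hc₀ e1.symm
  -- `q⁽ᴺ⁾(s, t) = χ_t(m)`
  have hNt : (N : ℤ) • t = 0 := by
    rw [natCast_zsmul]
    apply pointChar_injective Φ
    funext n
    rw [pointChar_nsmul_left, ← pointChar_nsmul A, hχN, pointChar_zero]
    rfl
  have htors : torsionPairing Φ (N : ℤ) s t = pointChar Φ t m := by
    have hs : s = proj Φ (Φ.symm sv) := by rw [← hsv, cover_apply]
    rw [hs]
    refine torsionPairing_proj_eq_pointChar Φ (N : ℤ) ?_ ((mem_ker_mapMatrixHom_smul_one_iff _ _ _).2 hNt)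
    rw [Int.cast_natCast, Nat.cast_smul_eq_nsmul, ← map_nsmul, hm]
    exact (ContinuousLinearEquiv.symm_apply_apply Φ (intVec m))
  rw [htors]
  -- from `c · w(x) · χ_t(m) · G_i(Nv) = c₀ = w(x) · G_i(Nv)` cancel `w(x) · G_i(Nv) ≠ 0`
  have hid : (algebraMap ℂ ℂ) (A.kummerConst hh σ) = A.kummerConst hh σ := rfl
  rw [hid] at hval
  rw [hval] at e2
  have e3 : A.kummerConst hh σ * pointChar Φ t m * (evalOrZero W w (φ (cover Φ v)) * G i (N • v)) =
      1 * (evalOrZero W w (φ (cover Φ v)) * G i (N • v)) :=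
    calc A.kummerConst hh σ * pointChar Φ t m * (evalOrZero W w (φ (cover Φ v)) * G i (N • v))
        = A.kummerConst hh σ * evalOrZero W w (φ (cover Φ v)) * (pointChar Φ t m * G i (N • v)) := by ring
      _ = c₀ := e2
      _ = evalOrZero W w (φ (cover Φ v)) * G i (N • v) := e1.symm
      _ = 1 * (evalOrZero W w (φ (cover Φ v)) * G i (N • v)) := (one_mul _).symm
  exact mul_right_cancel₀ (mul_ne_zero hwx hG) e3

include hφ hadd in
/-- **`e_N(σ, D) = q⁽ᴺ⁾(s, t)⁻¹`** — the junction in quotient form. [cite: Lang1983AbelianVarieties, Ch. VII §2 Props. 3–5]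
[cite: Lange2023AbelianVarietiesComplex, §2.7.4 Exercise (3)] -/
theorem kummerConst_eq_torsionPairing_inv {N : ℕ} [IsDominant (Hom.toSchemeHom ((N : ℤ) • 𝟙 A))]
    (D : CartierDivisor A.X.left) {h : A.X.left.functionField} (hh : A.IsTrivializer (n := N) D h)
    (t : Dual Φ)
    (ht : ((dualEquivPicZero Φ (Multiplicative.ofAdd t) : picZero Φ) : Pic Φ) =
      picClass (cartierDivisorLineBundle hφ D))
    (s : ComplexTorus Φ) (σ : A.torsionPoints ℂ N) (hσ : (σ : A.Points ℂ) = φ s) :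
    (A.kummerConst hh σ : ℂ) = (torsionPairing Φ (N : ℤ) s t)⁻¹ := by
  have h1 := kummerConst_mul_torsionPairing_eq_one hφ hadd D hh t ht s σ hσ
  have hne : torsionPairing Φ (N : ℤ) s t ≠ 0 := by
    intro h0
    rw [h0, mul_zero] at h1
    exact zero_ne_one h1
  exact eq_inv_of_mul_eq_one_left h1

end KummerAnalytic

end Literature.AlgebraicGeometry.Motives.AbelianVariety

end
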